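import Literature.Topology.FourManifolds.TautFoliationsContourSquare
import Mathlib.Topology.OpenPartialHomeomorph.Constructions
import HarnessLib

/-!
# Contour charts of the cone of a square (roof apex): the corner sectors

Topic: sequel to `TautFoliationsContourSquare.lean`. The punctured square `Q ∖ {c}` with the
contour foliation of the roof-apex cone is identified with the region
`{(q, h) | q ∈ ∂Q, ψ q ≤ h < m}` by `x ↦ (proj x, coneHt x)`. To obtain genuine planar charts one
needs a real coordinate along the boundary `∂Q`; near the bottom-right corner of the square the
linear function `q ↦ q.1 + q.2` is such a coordinate (it increases along the bottom edge and
then along the right edge), with the explicit inverse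
`λ ↦ (min (λ - (c.2 - ℓ)) (c.1 + ℓ), max (c.2 - ℓ) (λ - (c.1 + ℓ)))` (`brArc`). This file
builds the corresponding **contour chart of the open bottom-right sector**:

* `brArc` (**definition**) and its algebra (`brArc_mem_sphere`, `sum_brArc`, `brArc_sum`);
* `brChart` (**definition**): the open partial homeomorphism
  `x ↦ ((proj x).1 + (proj x).2, coneHt x)` of the plane with source the open sector
  `{x ∈ Q° ∖ {c} | (proj x).1 - (proj x).2 > c.1 - c.2}` and target the open region
  `{(λ, h) | |λ - (c.1 + c.2)| < 2ℓ, ψ (brArc λ) < h < m}`, with inverse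
  `(λ, h) ↦ levelPt (brArc λ) h`; its second coordinate is the cone height, so its level sets
  are the contour lines: after renormalisation (`Renorm.lean`) these are flow boxes of the
  induced foliation at the interior points of the sector. The other three sectors are obtained
  by the symmetries of the square (later files).

All statements are [folklore] (elementary real analysis).
-/

noncomputable section

open Set Filter Metric Topology

namespace Literature.Topology.FourManifolds

namespace ConeSquare

variable {c : ℝ × ℝ} {ℓ m : ℝ} {ψ : ℝ × ℝ → ℝ} {x q : ℝ × ℝ} {lam h : ℝ}

/-! ## The bottom-right boundary arc parametrised by the sum of the coordinates -/

/-- The point of the bottom-right boundary arc (bottom edge then right edge) with coordinate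
sum `λ`. [folklore] -/
def brArc (c : ℝ × ℝ) (ℓ lam : ℝ) : ℝ × ℝ :=
  (min (lam - (c.2 - ℓ)) (c.1 + ℓ), max (c.2 - ℓ) (lam - (c.1 + ℓ)))

/-- `brArc` is continuous. [folklore] -/
theorem continuous_brArc (c : ℝ × ℝ) (ℓ : ℝ) : Continuous (brArc c ℓ) := by
  unfold brArc; fun_prop

/-- The coordinate sum of `brArc λ` is `λ`. [folklore] -/
theorem sum_brArc (c : ℝ × ℝ) (ℓ lam : ℝ) : (brArc c ℓ lam).1 + (brArc c ℓ lam).2 = lam := by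
  simp only [brArc]
  rcases le_total (lam - (c.2 - ℓ)) (c.1 + ℓ) with h | h
  · rw [min_eq_left h, max_eq_left (by linarith)]; ring
  · rw [min_eq_right h, max_eq_right (by linarith)]; ring

/-- **`brArc λ` lies on the boundary of the square** for `|λ - (c.1 + c.2)| < 2ℓ`. [folklore] -/
theorem brArc_mem_sphere (hℓ : 0 < ℓ) (hlam : lam ∈ Ioo (c.1 + c.2 - 2 * ℓ) (c.1 + c.2 + 2 * ℓ)) :
    brArc c ℓ lam ∈ sphere c ℓ := by
  rw [mem_sphere, Prod.dist_eq, Real.dist_eq, Real.dist_eq]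
  rcases le_total (lam - (c.2 - ℓ)) (c.1 + ℓ) with h | h
  · -- bottom edge
    have h1 : (brArc c ℓ lam).1 = lam - (c.2 - ℓ) := min_eq_left h
    have h2 : (brArc c ℓ lam).2 = c.2 - ℓ := max_eq_left (by linarith)
    rw [h1, h2, show c.2 - ℓ - c.2 = -ℓ by ring, abs_neg, abs_of_pos hℓ]
    exact max_eq_right (abs_le.2 ⟨by linarith [hlam.1], by linarith⟩)
  · -- right edge
    have h1 : (brArc c ℓ lam).1 = c.1 + ℓ := min_eq_right h
    have h2 : (brArc c ℓ lam).2 = lam - (c.1 + ℓ) := max_eq_right (by linarith)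
    rw [h1, h2, show c.1 + ℓ - c.1 = ℓ by ring, abs_of_pos hℓ]
    exact max_eq_left (abs_le.2 ⟨by linarith, by linarith [hlam.2]⟩)

/-- `brArc λ` is in the open bottom-right arc: `q.1 - q.2 > c.1 - c.2`. [folklore] -/
theorem brArc_fst_sub_snd (hlam : lam ∈ Ioo (c.1 + c.2 - 2 * ℓ) (c.1 + c.2 + 2 * ℓ)) :
    c.1 - c.2 < (brArc c ℓ lam).1 - (brArc c ℓ lam).2 := by
  simp only [brArc]
  rcases le_total (lam - (c.2 - ℓ)) (c.1 + ℓ) with h | h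
  · rw [min_eq_left h, max_eq_left (by linarith)]; linarith [hlam.1]
  · rw [min_eq_right h, max_eq_right (by linarith)]; linarith [hlam.2]

/-- **A boundary point of the open bottom-right arc is `brArc` of its coordinate sum.**
[folklore] -/
theorem brArc_sum (hℓ : 0 < ℓ) (hq : q ∈ sphere c ℓ) (harc : c.1 - c.2 < q.1 - q.2) : brArc c ℓ (q.1 + q.2) = q := by
  rw [mem_sphere, Prod.dist_eq, Real.dist_eq, Real.dist_eq] at hq
  have h1 : |q.1 - c.1| ≤ ℓ := by rw [← hq]; exact le_max_left _ _
  have h2 : |q.2 - c.2| ≤ ℓ := by rw [← hq]; exact le_max_right _ _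
  rw [abs_le] at h1 h2
  simp only [brArc]
  -- on the arc, either `q.2 = c.2 - ℓ` (bottom) or `q.1 = c.1 + ℓ` (right)
  rcases max_choice |q.1 - c.1| |q.2 - c.2| with hm | hm
  · -- `|q.1 - c.1| = ℓ`: then `q.1 = c.1 + ℓ` (the left edge is excluded by `harc`)
    rw [hm] at hq
    have hq1 : q.1 = c.1 + ℓ := by
      rcases abs_eq (hℓ.le) |>.1 hq with h | h
      · linarith
      · exfalso; linarith
    ext
    · rw [hq1]; simp only; exact min_eq_right (by linarith)
    · rw [hq1]; simp only; rw [max_eq_right (by linarith)]; ring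
  · rw [hm] at hq
    have hq2 : q.2 = c.2 - ℓ := by
      rcases abs_eq (hℓ.le) |>.1 hq with h | h
      · exfalso; linarith
      · linarith
    ext
    · rw [hq2]; simp only; rw [min_eq_left (by linarith)]; ring
    · rw [hq2]; simp only; exact max_eq_left (by linarith)

/-- The coordinate sum of a point of the open bottom-right arc lies in the parameter interval.
[folklore] -/
theorem sum_mem_Ioo (hq : q ∈ sphere c ℓ) (harc : c.1 - c.2 < q.1 - q.2) :
    q.1 + q.2 ∈ Ioo (c.1 + c.2 - 2 * ℓ) (c.1 + c.2 + 2 * ℓ) := by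
  rw [mem_sphere, Prod.dist_eq, Real.dist_eq, Real.dist_eq] at hq
  have h1 : |q.1 - c.1| ≤ ℓ := by rw [← hq]; exact le_max_left _ _
  have h2 : |q.2 - c.2| ≤ ℓ := by rw [← hq]; exact le_max_right _ _
  rw [abs_le] at h1 h2
  constructor
  · -- `q.1 + q.2 > c.1 + c.2 - 2ℓ` unless `q` is the bottom-left corner, excluded by `harc`
    by_contra hle; push Not at hle
    have : q.1 = c.1 - ℓ ∧ q.2 = c.2 - ℓ := ⟨by linarith, by linarith⟩
    linarith [this.1, this.2]
  · by_contra hle; push Not at hle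
    have : q.1 = c.1 + ℓ ∧ q.2 = c.2 + ℓ := ⟨by linarith, by linarith⟩
    linarith [this.1, this.2]

/-! ## The contour chart of the bottom-right sector -/

/-- The open bottom-right sector of the punctured open square. [folklore] -/
def brSector (c : ℝ × ℝ) (ℓ : ℝ) : Set (ℝ × ℝ) :=
  {x | x ∈ ball c ℓ ∧ x ≠ c ∧ c.1 - c.2 < (proj c ℓ x).1 - (proj c ℓ x).2}

/-- The target region of the bottom-right contour chart. [folklore] -/
def brRegion (c : ℝ × ℝ) (ℓ m : ℝ) (ψ : ℝ × ℝ → ℝ) : Set (ℝ × ℝ) :=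
  {p | p.1 ∈ Ioo (c.1 + c.2 - 2 * ℓ) (c.1 + c.2 + 2 * ℓ) ∧ ψ (brArc c ℓ p.1) < p.2 ∧ p.2 < m}

/-- The sector is open. [folklore] -/
theorem isOpen_brSector (c : ℝ × ℝ) (ℓ : ℝ) : IsOpen (brSector c ℓ) := by
  have h1 : IsOpen ({x : ℝ × ℝ | x ≠ c} ∩ (fun x ↦ (proj c ℓ x).1 - (proj c ℓ x).2) ⁻¹' Ioi (c.1 - c.2)) := by
    refine ContinuousOn.isOpen_inter_preimage ?_ isOpen_ne isOpen_Ioi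
    exact (continuous_fst.comp_continuousOn (continuousOn_proj c ℓ)).sub
      (continuous_snd.comp_continuousOn (continuousOn_proj c ℓ))
  have : brSector c ℓ = ball c ℓ ∩ ({x : ℝ × ℝ | x ≠ c} ∩ (fun x ↦ (proj c ℓ x).1 - (proj c ℓ x).2) ⁻¹' Ioi (c.1 - c.2)) := by
    ext x; simp only [brSector, mem_setOf_eq, mem_inter_iff, mem_preimage, mem_Ioi]
  rw [this]
  exact isOpen_ball.inter h1

/-- The region is open (boundary heights continuous on the boundary). [folklore] -/
theorem isOpen_brRegion (hℓ : 0 < ℓ) (hψ : ContinuousOn ψ (sphere c ℓ)) : IsOpen (brRegion c ℓ m ψ) := by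
  have hI : IsOpen {p : ℝ × ℝ | p.1 ∈ Ioo (c.1 + c.2 - 2 * ℓ) (c.1 + c.2 + 2 * ℓ)} := isOpen_Ioo.preimage continuous_fst
  have hcont : ContinuousOn (fun p : ℝ × ℝ ↦ ψ (brArc c ℓ p.1)) {p | p.1 ∈ Ioo (c.1 + c.2 - 2 * ℓ) (c.1 + c.2 + 2 * ℓ)} :=
    hψ.comp ((continuous_brArc c ℓ).comp continuous_fst).continuousOn fun p hp ↦ brArc_mem_sphere hℓ hp
  have h2 : IsOpen ({p : ℝ × ℝ | p.1 ∈ Ioo (c.1 + c.2 - 2 * ℓ) (c.1 + c.2 + 2 * ℓ)} ∩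
      (fun p : ℝ × ℝ ↦ p.2 - ψ (brArc c ℓ p.1)) ⁻¹' Ioi 0) :=
    (continuous_snd.continuousOn.sub hcont).isOpen_inter_preimage hI isOpen_Ioi
  have h3 : IsOpen {p : ℝ × ℝ | p.2 < m} := isOpen_lt continuous_snd continuous_const
  have : brRegion c ℓ m ψ = ({p : ℝ × ℝ | p.1 ∈ Ioo (c.1 + c.2 - 2 * ℓ) (c.1 + c.2 + 2 * ℓ)} ∩
      (fun p : ℝ × ℝ ↦ p.2 - ψ (brArc c ℓ p.1)) ⁻¹' Ioi 0) ∩ {p | p.2 < m} := by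
    ext p
    simp only [brRegion, mem_setOf_eq, mem_inter_iff, mem_preimage, mem_Ioi, sub_pos]
    tauto
  rw [this]
  exact h2.inter h3

/-- **The contour chart of the bottom-right sector** (roof apex `m`, boundary heights `ψ < m`
continuous on the boundary): `x ↦ ((proj x).1 + (proj x).2, coneHt x)` with inverse
`(λ, h) ↦ levelPt (brArc λ) h`. [folklore] -/
def brChart (c : ℝ × ℝ) (ℓ m : ℝ) (ψ : ℝ × ℝ → ℝ) (hℓ : 0 < ℓ) (hm : ∀ q ∈ sphere c ℓ, ψ q < m)
    (hψ : ContinuousOn ψ (sphere c ℓ)) : OpenPartialHomeomorph (ℝ × ℝ) (ℝ × ℝ) where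
  toFun x := ((proj c ℓ x).1 + (proj c ℓ x).2, coneHt c ℓ m ψ x)
  invFun p := levelPt c m ψ (brArc c ℓ p.1) p.2
  source := brSector c ℓ
  target := brRegion c ℓ m ψ
  map_source' := by
    rintro x ⟨hxb, hxc, harc⟩
    have hq := proj_mem_sphere hℓ x (c := c)
    refine ⟨sum_mem_Ioo hq harc, ?_, coneHt_lt_apex hℓ hm hxc⟩
    simp only
    rw [brArc_sum hℓ hq harc]
    -- strictly above the boundary height: `x` is in the open square
    have hle := le_coneHt hℓ hm (ball_subset_closedBall hxb)
    rcases hle.lt_or_eq with hlt | heq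
    · exact hlt
    · exfalso
      -- equality of heights means `x` is on the boundary
      have hx : x = levelPt c m ψ (proj c ℓ x) (coneHt c ℓ m ψ x) := eq_levelPt_of_coneHt_eq hℓ hm rfl
      have hmem : levelPt c m ψ (proj c ℓ x) (coneHt c ℓ m ψ x) ∈ sphere c ℓ :=
        (levelPt_mem_sphere_iff hℓ hq (hm _ hq) (coneHt_lt_apex hℓ hm hxc).le).2 heq
      rw [← hx] at hmem
      rw [mem_sphere] at hmem
      rw [mem_ball] at hxb
      exact absurd hmem (ne_of_lt hxb)
  map_target' := by
    rintro ⟨lam, h⟩ ⟨hlam, hψh, hhm⟩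
    have hq := brArc_mem_sphere hℓ hlam (c := c)
    refine ⟨(levelPt_mem_ball_iff hℓ hq (hm _ hq) hhm.le).2 hψh, ?_, ?_⟩
    · intro heq
      exact absurd ((levelPt_eq_center_iff hℓ hq (hm _ hq) hhm.le).1 heq) (ne_of_lt hhm)
    · simp only
      rw [proj_levelPt hℓ hq (hm _ hq) hhm]
      exact brArc_fst_sub_snd hlam
  left_inv' := by
    rintro x ⟨hxb, hxc, harc⟩
    simp only
    rw [brArc_sum hℓ (proj_mem_sphere hℓ x) harc]
    exact levelPt_proj_coneHt hℓ hm x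
  right_inv' := by
    rintro ⟨lam, h⟩ ⟨hlam, hψh, hhm⟩
    have hq := brArc_mem_sphere hℓ hlam (c := c)
    simp only
    rw [proj_levelPt hℓ hq (hm _ hq) hhm, coneHt_levelPt hℓ hq (hm _ hq) hhm.le, sum_brArc]
  open_source := isOpen_brSector c ℓ
  open_target := isOpen_brRegion hℓ hψ
  continuousOn_toFun := by
    have hsub : brSector c ℓ ⊆ {c}ᶜ := fun x hx ↦ hx.2.1
    refine ContinuousOn.prodMk ?_ ((continuousOn_coneHt hℓ hψ).mono hsub)
    exact ((continuous_fst.comp_continuousOn (continuousOn_proj c ℓ)).add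
      (continuous_snd.comp_continuousOn (continuousOn_proj c ℓ))).mono hsub
  continuousOn_invFun := by
    have h1 : ContinuousOn (fun p : ℝ × ℝ ↦ (brArc c ℓ p.1, p.2)) (brRegion c ℓ m ψ) :=
      (((continuous_brArc c ℓ).comp continuous_fst).prodMk continuous_snd).continuousOn
    have h2 := continuousOn_levelPt hm hψ (c := c)
    exact h2.comp h1 fun p hp ↦ ⟨brArc_mem_sphere hℓ hp.1, mem_univ _⟩

/-- The source of the bottom-right contour chart. [folklore] -/
@[simp] theorem brChart_source (hℓ : 0 < ℓ) (hm : ∀ q ∈ sphere c ℓ, ψ q < m) (hψ : ContinuousOn ψ (sphere c ℓ)) :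
    (brChart c ℓ m ψ hℓ hm hψ).source = brSector c ℓ := rfl

/-- The target of the bottom-right contour chart. [folklore] -/
@[simp] theorem brChart_target (hℓ : 0 < ℓ) (hm : ∀ q ∈ sphere c ℓ, ψ q < m) (hψ : ContinuousOn ψ (sphere c ℓ)) :
    (brChart c ℓ m ψ hℓ hm hψ).target = brRegion c ℓ m ψ := rfl

/-- The bottom-right contour chart reads the coordinate sum of the projection and the height.
[folklore] -/
theorem brChart_apply (hℓ : 0 < ℓ) (hm : ∀ q ∈ sphere c ℓ, ψ q < m) (hψ : ContinuousOn ψ (sphere c ℓ)) (x : ℝ × ℝ) :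
    brChart c ℓ m ψ hℓ hm hψ x = ((proj c ℓ x).1 + (proj c ℓ x).2, coneHt c ℓ m ψ x) := rfl

/-- **The height read by the chart is the cone height**: its level sets are the contour lines.
[folklore] -/
theorem brChart_snd (hℓ : 0 < ℓ) (hm : ∀ q ∈ sphere c ℓ, ψ q < m) (hψ : ContinuousOn ψ (sphere c ℓ)) (x : ℝ × ℝ) :
    (brChart c ℓ m ψ hℓ hm hψ x).2 = coneHt c ℓ m ψ x := rfl

/-- **Every point of the punctured open square whose projection is on the open bottom-right arc
lies in the sector.** [folklore] -/
theorem mem_brSector (hxb : x ∈ ball c ℓ) (hxc : x ≠ c) (harc : c.1 - c.2 < (proj c ℓ x).1 - (proj c ℓ x).2) :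
    x ∈ brSector c ℓ := ⟨hxb, hxc, harc⟩

end ConeSquare

end Literature.Topology.FourManifolds
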